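import Summits.BirchSwinnertonDyer.Rank1Residual.GaloisImage.LocalUnitsModPMilneCount
import Summits.BirchSwinnertonDyer.Rank1Residual.GaloisImage.TrivialActionHOneDescent
import Summits.BirchSwinnertonDyer.Rank1Residual.GaloisImage.EquivariantHomDualCount
import Summits.BirchSwinnertonDyer.Rank1Residual.GaloisImage.RootsOfUnityTorsionUnits
import Summits.BirchSwinnertonDyer.Rank1Residual.GaloisImage.EPCRepresentationGlue
import Summits.BirchSwinnertonDyer.Rank1Residual.GaloisImage.EPCLocalFieldGlue
import Summits.BirchSwinnertonDyer.Rank1Residual.GaloisImage.QuotientPowCount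
import Literature.NumberTheory.GaloisRepresentations.LocalDualityTwoZero
import Literature.NumberTheory.GaloisRepresentations.LocalEulerPoincareCharacteristic
import HarnessLib

/-!
# Tate's local Euler–Poincaré characteristic over the tame layer
# (cell `b2b-bsdres`, team n1011, row T-EPC = Tate's local Euler–Poincaré characteristic; seat p04 GEN 8; stage C5)

HONEST FRAMING (cell `b2b-bsdres`, run/shared/lean/b2b/bsd-rank1-residual/, verbatim in every
file): the goal of the cell is to DELETE the COMBINATION-SHAPED residual classes of the
Birch–Swinnerton-Dyer formula for ALL analytic-rank `≤ 1` elliptic curves over `ℚ` — "full BSD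
formula for every rank `≤ 1` curve in class `C`" assembled STRICTLY from published theorems — so
that the rank-`≤ 1` remainder becomes exactly the CONSTRUCTION-SHAPED classes, which are TYPED
(missing-input `Prop`s), NOT attempted. This is not "finishing BSD". Team n1011 (N10 / N11, the
additive block X4 ∧ `p = 3`): research route; no claim beyond the stated classes; nothing is
booked; no mark / label is changed by this file. Theorems only (no definition, no named fact, no
`sorry`).  (Placement: Summits/GaloisImage with the T-EPC cone.)

## What

**Tate's formula `#H⁰(K, M) · #H²(K, M) · (𝒪_K : #M · 𝒪_K) = #H¹(K, M)` for the tame layer**: `K` a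
non-archimedean local field of characteristic `0` with `|p| < 1`, `E/K` a finite Galois
subextension of `K̄` of degree prime to `p` containing `μ_p`, and `M` a finite discrete `Γ_K`-module
killed by `p` on which `Gal(K̄/E)` acts trivially (`TameLayer.localEulerPoincare`).  This is the
case of Milne, *ADT* I Thm. 2.8 to which the wild / unramified-`p` dévissage (stage D) reduces the
general finite module; its proof here is Milne's (pp. 33–34) with Lemma 2.10 (Brauer induction)
replaced by restriction to the tame subgroup:

* `h² = #Hom_Γ(M, μ_p)` — local duality in bidegree `(2,0)` (tree, `natCard_two_eq_natCard_invariants_homRep`);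
* `h¹ = #{Γ-equivariant continuous homomorphisms Gal(K̄/E) → M}` (stage C1) `= #Hom_Γ(M^D, Eˣ/Eˣᵖ)`
  (equivariant Kummer theory, stages C2–C3) `= #(𝒪_K/p)^r · #Hom_Γ(M^D, μ_p) · #(M^D)^Γ`
  (Milne's Lemma 2.11, stage B7, `#M = p^r`) `= (𝒪_K : #M 𝒪_K) · h⁰ · h²`.

References: J. S. Milne, *Arithmetic Duality Theorems* (2006), I §2 Thm. 2.8 and Lemmas 2.11–2.12
[MilneADT2006]; J.-P. Serre, *Galois Cohomology* (1997), II §5.7 Thm. 5 [SerreGaloisCohomology1997].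
-/

noncomputable section

open CategoryTheory Function Field
open scoped ValuativeRel
open Literature.NumberTheory.GaloisRepresentations
open Literature.NumberTheory.GaloisRepresentations.DiscreteGaloisModule
open Literature.NumberTheory.GaloisRepresentations.LocalWeilDatum
open Literature.NumberTheory.EllipticCurves (subgroupConj subgroupConj_apply_coe)

universe u

namespace Summit.BirchSwinnertonDyer.Rank1Residual.GaloisImage

namespace TameLayer

variable (K : Type u) [Field K] [ValuativeRel K] [TopologicalSpace K] [IsNonarchimedeanLocalField K]
  [CharZero K]
variable (p : ℕ) [hp : Fact p.Prime]
variable (E : IntermediateField K (AlgebraicClosure K)) [FiniteDimensional K E] [IsGalois K E]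
variable {M : Type u} [AddCommGroup M] [TopologicalSpace M] [DiscreteTopology M] [Finite M]
  (ρ : ContinuousRep (absoluteGaloisGroup K) ℤ M)

omit [ValuativeRel K] [TopologicalSpace K] [IsNonarchimedeanLocalField K] [CharZero K] hp
  [FiniteDimensional K E] [IsGalois K E] in
/-- `Gal(K̄/E)` acts trivially on `M^D = Hom(M, μ_p)` when it acts trivially on `M` and on `μ_p`.
[folklore] -/
theorem homRep_apply_eq_self_of_mem
    (hμ : ∀ g ∈ galFixing K E, ∀ ζ : MuCarrier K p, mu K p g ζ = ζ)
    (hNM : ∀ g ∈ galFixing K E, ∀ m : M, ρ g m = m)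
    (g : absoluteGaloisGroup K) (hg : g ∈ galFixing K E) (f : HomCarrier M (MuCarrier K p)) :
    ρ.homRep (mu K p) g f = f := by
  rw [ContinuousRep.homRep_apply_eq_self_iff]
  intro m
  rw [hμ g hg, hNM g hg]

omit [ValuativeRel K] [TopologicalSpace K] [IsNonarchimedeanLocalField K] [CharZero K] in
/-- `#(M^D)^Γ` does not depend on how the exponent of `μ` is written. [folklore] -/
theorem natCard_invariants_homRep_mu_congr {n m : ℕ} (h : n = m) :
    Nat.card (ρ.homRep (mu K n)).toTopRep.ρ.invariants =
      Nat.card (ρ.homRep (mu K m)).toTopRep.ρ.invariants := by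
  subst h; rfl

omit [ValuativeRel K] [TopologicalSpace K] [IsNonarchimedeanLocalField K] in
/-- **Step 1 (`h¹` through Kummer theory)**: `#H¹(K, M) = #Hom_Γ(M^D, Eˣ/Eˣᵖ)` with `Γ_K` acting on
`Eˣ/Eˣᵖ` through `Gal(E/K)` (stages C1, C3a, C3b and `M ≅ M^{DD}`).
[cite: MilneADT2006, I §2 proof of Thm 2.8 (pp. 33–34)] -/
theorem natCard_one_eq_natCard_intertwiningMap
    (hG : ¬ p ∣ (galFixing K E).index)
    (hμ : ∀ g ∈ galFixing K E, ∀ ζ : MuCarrier K p, mu K p g ζ = ζ)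
    (hpM : ∀ m : M, p • m = 0) (hNM : ∀ g ∈ galFixing K E, ∀ m : M, ρ g m = m) :
    Nat.card (continuousCohomology 1 ρ.toTopRep) =
      Nat.card (Representation.IntertwiningMap (ρ.homRep (mu K p)).toRepresentation
        (Representation.quotient
          ((Representation.ofMulDistribMulAction (↥E ≃ₐ[K] ↥E) (↥E)ˣ).comp (resGal E)) _
          (ModPRepCount.range_lsmul_le_comap
            ((Representation.ofMulDistribMulAction (↥E ≃ₐ[K] ↥E) (↥E)ˣ).comp (resGal E)) p))) := by
  classical
  haveI : (galFixing K E).Normal := normal_galFixing E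
  haveI : NeZero p := ⟨hp.out.ne_zero⟩
  haveI : Fintype (absoluteGaloisGroup K ⧸ galFixing K E) :=
    @Fintype.ofFinite _ (EPCLocalField.finite_quotient_galFixing K E)
  haveI : Finite (MuCarrier K p) := finite_muCarrier K p
  -- C1: `h¹ = #{Γ-invariant cocycles N → M}`
  rw [TrivialAction.natCard_continuousCohomology_one_eq ρ (galFixing K E) (isOpen_galFixing K E)
    (TrivialAction.bijective_index_smul_of_prime (galFixing K E) hpM hG) hNM]
  -- `M ≅ M^{DD}`
  rw [EPCGlue.natCard_invariantCocycles_congr (galFixing K E) (ρ.biDualIso (mu K p) (muEquivZMod K p) hpM)]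
  -- Kummer + swap
  obtain ⟨Ψ, hbij, -, hΨ⟩ := KummerSubgroup.exists_equivariant_bijective K p E hp.out.pos hμ
  exact EquivariantHom.natCard_invariant_cocycles_homRep_eq_of_bijective (galFixing K E) (mu K p)
    (ρ.homRep (mu K p)) _ hμ (homRep_apply_eq_self_of_mem K p E ρ hμ hNM) Ψ hbij hΨ

omit [ValuativeRel K] [TopologicalSpace K] [IsNonarchimedeanLocalField K] [CharZero K] hp
  [FiniteDimensional K E] in
/-- **Step 2 (descent to `Gal(E/K)`)**: for the descended action `σ'` of `Gal(E/K)` on `M^D`,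
`#Hom_Γ(M^D, Eˣ/Eˣᵖ) = #Hom_{Gal(E/K)}(M^D, Eˣ/Eˣᵖ)`. [folklore] -/
theorem natCard_intertwiningMap_descend
    (σ' : Representation ℤ (↥E ≃ₐ[K] ↥E) (HomCarrier M (MuCarrier K p)))
    (hσ' : ∀ g f, σ' (resGal E g) f = (ρ.homRep (mu K p)).toRepresentation g f) :
    Nat.card (Representation.IntertwiningMap (ρ.homRep (mu K p)).toRepresentation
        (Representation.quotient
          ((Representation.ofMulDistribMulAction (↥E ≃ₐ[K] ↥E) (↥E)ˣ).comp (resGal E)) _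
          (ModPRepCount.range_lsmul_le_comap
            ((Representation.ofMulDistribMulAction (↥E ≃ₐ[K] ↥E) (↥E)ˣ).comp (resGal E)) p))) =
      Nat.card (Representation.IntertwiningMap σ'
        ((Representation.ofMulDistribMulAction (↥E ≃ₐ[K] ↥E) (↥E)ˣ).quotient _
          (ModPRepCount.range_lsmul_le_comap
            (Representation.ofMulDistribMulAction (↥E ≃ₐ[K] ↥E) (↥E)ˣ) p))) := by
  set ρU := Representation.ofMulDistribMulAction (↥E ≃ₐ[K] ↥E) (↥E)ˣ with hρU
  rw [← EPCGlue.natCard_intertwiningMap_comp_of_surjective (resGal E) (resGal_surjective E) σ']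
  refine EPCGlue.natCard_intertwiningMap_congr_of_eq (fun g f => (hσ' g f).symm) fun g x => ?_
  induction x using Submodule.Quotient.induction_on with
  | H y =>
  rw [Representation.quotient_apply, Submodule.mapQ_apply]
  change _ = (ρU.quotient _ (ModPRepCount.range_lsmul_le_comap ρU p)) (resGal E g) (Submodule.Quotient.mk y)
  rw [Representation.quotient_apply, Submodule.mapQ_apply]
  rfl

omit [ValuativeRel K] [TopologicalSpace K] [IsNonarchimedeanLocalField K] [FiniteDimensional K E] in
/-- **Step 3 (the torsion term)**: `#Hom_{Gal(E/K)}(M^D, Eˣ[p]) = #M^{Γ}` (`Eˣ[p] = μ_p`,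
`Hom_Γ(M^D, μ_p) = (M^{DD})^Γ`, `M ≅ M^{DD}`). [cite: MilneADT2006, I §2 proof of Thm 2.8] -/
theorem natCard_intertwiningMap_torsion_eq
    (hμ : ∀ g ∈ galFixing K E, ∀ ζ : MuCarrier K p, mu K p g ζ = ζ) (hpM : ∀ m : M, p • m = 0)
    (σ' : Representation ℤ (↥E ≃ₐ[K] ↥E) (HomCarrier M (MuCarrier K p)))
    (hσ' : ∀ g f, σ' (resGal E g) f = (ρ.homRep (mu K p)).toRepresentation g f) :
    Nat.card (Representation.IntertwiningMap σ'
        ((Representation.ofMulDistribMulAction (↥E ≃ₐ[K] ↥E) (↥E)ˣ).subrepresentation _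
          (ModPRepCount.ker_lsmul_le_comap
            (Representation.ofMulDistribMulAction (↥E ≃ₐ[K] ↥E) (↥E)ˣ) p))) =
      Nat.card ρ.toTopRep.ρ.invariants := by
  haveI : NeZero p := ⟨hp.out.ne_zero⟩
  haveI : Finite (MuCarrier K p) := finite_muCarrier K p
  rw [← EPCGlue.natCard_intertwiningMap_comp_of_surjective (resGal E) (resGal_surjective E) σ']
  obtain ⟨e⟩ := KummerSubgroup.nonempty_equiv_mu_torsionUnits K p E hμ
  rw [← ModPRepCount.natCard_intertwiningMap_congr_right _ _ _ e,
    EPCGlue.natCard_intertwiningMap_congr_of_eq (σ₂ := (ρ.homRep (mu K p)).toRepresentation)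
      (τ₂ := (mu K p).toRepresentation) hσ' (fun g y => rfl),
    EPCGlue.natCard_intertwiningMap_eq_natCard_invariants_homRep]
  exact (EPCGlue.natCard_invariants_congr ρ (ρ.biDualIso (mu K p) (muEquivZMod K p) hpM)).symm

omit [ValuativeRel K] [TopologicalSpace K] [IsNonarchimedeanLocalField K] [CharZero K] hp
  [FiniteDimensional K E] in
/-- **Step 4 (the invariants term)**: `#(M^D)^{Gal(E/K)} = #(M^D)^{Γ}`. [folklore] -/
theorem natCard_invariants_descend
    (σ' : Representation ℤ (↥E ≃ₐ[K] ↥E) (HomCarrier M (MuCarrier K p)))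
    (hσ' : ∀ g f, σ' (resGal E g) f = (ρ.homRep (mu K p)).toRepresentation g f) :
    Nat.card σ'.invariants = Nat.card (ρ.homRep (mu K p)).toTopRep.ρ.invariants := by
  rw [← EPCGlue.natCard_invariants_comp_of_surjective (resGal E) (resGal_surjective E) σ']
  refine Nat.card_congr
    { toFun := fun f => ⟨f.1, fun g => by
        have h := f.2 g
        change σ' (resGal E g) f.1 = f.1 at h
        rw [hσ'] at h
        exact h⟩
      invFun := fun f => ⟨f.1, fun g => by
        change σ' (resGal E g) f.1 = f.1
        rw [hσ']
        exact f.2 g⟩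
      left_inv := fun f => rfl
      right_inv := fun f => rfl }

/-- **Tate's local Euler–Poincaré characteristic formula over the tame layer.**  Let `K` be a
non-archimedean local field of characteristic `0` with `|p| < 1`, `E ⊆ K̄` a finite Galois extension
of `K` of degree prime to `p` with `μ_p(K̄) ⊆ E` (i.e. fixed by `Gal(K̄/E)`), and `M` a finite
discrete `Γ_K`-module killed by `p` on which `Gal(K̄/E)` acts trivially.  Then `H¹(K, M)` and
`H²(K, M)` are finite and

  `#M^{Γ_K} · #H²(K, M) · #(𝒪_K / (#M) 𝒪_K) = #H¹(K, M)`.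

(Milne, *ADT* I Thm. 2.8 for such `M`; proof: `(2,0)`-duality, restriction to the tame subgroup,
equivariant Kummer theory and Lemma 2.11 — stages B and C of this directory.)
[cite: MilneADT2006, I §2 Thm 2.8, Lemmas 2.11–2.12 (pp. 31–34)]
[cite: SerreGaloisCohomology1997, II §5.7 Thm. 5] -/
theorem localEulerPoincare (hpv : ValuativeRel.valuation K p < 1)
    (hG : ¬ p ∣ (galFixing K E).index)
    (hμ : ∀ g ∈ galFixing K E, ∀ ζ : MuCarrier K p, mu K p g ζ = ζ)
    (hpM : ∀ m : M, p • m = 0) (hNM : ∀ g ∈ galFixing K E, ∀ m : M, ρ g m = m) :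
    Finite (continuousCohomology 1 ρ.toTopRep) ∧ Finite (continuousCohomology 2 ρ.toTopRep) ∧
      Nat.card ρ.toTopRep.ρ.invariants * Nat.card (continuousCohomology 2 ρ.toTopRep) *
          Nat.card (𝒪[K] ⧸ Ideal.span {((Nat.card M : ℕ) : 𝒪[K])}) =
        Nat.card (continuousCohomology 1 ρ.toTopRep) := by
  classical
  haveI : (galFixing K E).Normal := normal_galFixing E
  haveI : NeZero p := ⟨hp.out.ne_zero⟩
  -- `#M = p^r`
  obtain ⟨r, hr⟩ := exists_card_eq_prime_pow M (fun m => ⟨1, by rw [pow_one]; exact hpM m⟩ :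
    IsPrimaryTorsion p M)
  -- `h²` by `(2,0)`-duality
  haveI : Finite (MuCarrier K p) := finite_muCarrier K p
  obtain ⟨hfin2, h2⟩ := natCard_two_eq_natCard_invariants_homRep K ρ (k := 1)
    (fun m => by rw [pow_one]; exact hpM m)
  have h2' : Nat.card (continuousCohomology 2 ρ.toTopRep) =
      Nat.card (ρ.homRep (mu K p)).toTopRep.ρ.invariants :=
    h2.trans (natCard_invariants_homRep_mu_congr K ρ (pow_one p))
  refine ⟨finite_galoisCohomology_one_of_isNonarchimedeanLocalField ρ, hfin2, ?_⟩
  -- the descended action of `Gal(E/K)` on `M^D`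
  have hker : ∀ g, resGal E g = 1 → ∀ f : HomCarrier M (MuCarrier K p),
      (ρ.homRep (mu K p)).toRepresentation g f = f := fun g hg f => by
    have hgN : g ∈ galFixing K E := by rw [← ker_resGal E]; exact hg
    exact homRep_apply_eq_self_of_mem K p E ρ hμ hNM g hgN f
  obtain ⟨σ', hσ'⟩ := EPCGlue.exists_representation_comp_eq (resGal E) (resGal_surjective E)
    (ρ.homRep (mu K p)).toRepresentation hker
  -- `h¹ = #Hom_Δ(M^D, Eˣ/p)`
  have h1 := (natCard_one_eq_natCard_intertwiningMap K p E ρ hG hμ hpM hNM).trans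
    (natCard_intertwiningMap_descend K p E ρ σ' hσ')
  -- Milne's Lemma 2.11 over `E/K`
  letI := FiniteExtension.valuativeRel K (↥E)
  letI := FiniteExtension.topologicalSpace K (↥E)
  haveI := FiniteExtension.isNonarchimedeanLocalField K (↥E)
  obtain ⟨OK, hOK₁, hOK₂⟩ := EPCLocalField.exists_submodule_integer K (↥E)
  have hGΔ : ¬ p ∣ Nat.card (↥E ≃ₐ[K] ↥E) := by rwa [← EPCLocalField.index_galFixing K E]
  have hcard : Nat.card (HomCarrier M (MuCarrier K p)) = p ^ r := by
    rw [HomCarrier.natCard_eq (muEquivZMod K p) hpM, hr]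
  have h211 := OneUnits.natCard_modP_field_units_eq (K := K) (E := ↥E) p
    ((EPCLocalField.valuation_natCast_lt_one_iff K (↥E) p).2 hpv) (EPCLocalField.valuation_algEquiv K (↥E))
    hGΔ σ' (HomCarrier.nsmul_eq_zero_of_left hpM) hcard OK hOK₁
  rw [h211, natCard_intertwiningMap_torsion_eq K p E ρ hμ hpM σ' hσ',
    natCard_invariants_descend K p E ρ σ' hσ', ← h2'] at h1
  -- the integer term
  have hint : Nat.card (OK ⧸ LinearMap.range (LinearMap.lsmul ℤ OK p)) ^ r =
      Nat.card (𝒪[K] ⧸ Ideal.span {((Nat.card M : ℕ) : 𝒪[K])}) := by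
    rw [OneUnits.natCard_quotient_integer_eq p OK hOK₂, hr, Nat.cast_pow,
      QuotientPow.natCard_quotient_span_pow (p : 𝒪[K]) (OneUnits.integer_hypotheses p hpv).1 r]
  rw [h1, ← hint]
  ring

end TameLayer

end Summit.BirchSwinnertonDyer.Rank1Residual.GaloisImage

end
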